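import Mathlib

/-!
# Slow rulers — the generic-step encoding behind the negative lemma on `LatticeGapInUVUnits` (pure Mathlib)

Negative-side support file for crux `stmt-QuantumFields-9366` =
`Summit.QuantumFields.YangMills.Theses.LangevinControlUV.LatticeGapInUVUnits` (route `LangevinControlUV`, rank 5).
No gauge theory is imported: this is the ORDER BOOKKEEPING showing that a femto two-point package of the shape used by
the route (two-sided bounds `c Γ(n a(β)) ≤ X ≤ C Γ(n a(β))` and `Y ≤ C Γ(dist · a(β))` on all boxes of side
`≤ ℓ₀ / a(β)`, ONE shape function `Γ ∈ (0, 1]` with no regularity, ANY unit map `a > 0`, `a → 0`) pins NO rate of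
decay of `a` from below as soon as the families `X, Y` obey fixed-side two-sided `β⁻²` bounds beyond arbitrary
side-dependent thresholds (`exists_slow_ruler`). The instantiation to Wilson's lattice gauge theory and the negative
lemma `latticeGapInUVUnits_false_of_standardScalingSU` live in
`Negative/LatticeGapInUVUnitsFalseOfStandardScalingSU.lean`.

* `irrational_sqrt_mul_of_prime`, `step_eq_of_sqrt_mul_eq` — GENERIC RULERS: if `u_k² = t_k √p_k` (`t_k ∈ ℚ_{>0}`,
  `p_k` the `k`-th prime) then `√m · u_k = √m' · u_j` (`m ≥ 1`) forces `k = j`; so the femto grids of different dyadic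
  steps never collide while each `u_k` can still be placed in any open interval (density of `ℚ`).
* `exists_slow_ruler_blocks` — the construction (docstring of the theorem); corollaries `exists_slow_ruler`
  (domination at the dyadic couplings) and `exists_slow_ruler_antitone` (domination on `[1, ∞)` for antitone floors).

This is the Lean form of crux-idea card `Cruxes/FemtoCurvatureTwoPoint/Ideas/generic-step-gamma-encoding` (its
`crux_of_encoding`, "provable now"), here turned AGAINST item 9366: see the negative lemma file.
-/

namespace Summit.QuantumFields.YangMills.Theorems.LatticeGapInUVUnits.Negative

open Filter Topology

noncomputable section

/-! ## Generic rulers: `√m · u_k = √m' · u_j` forces `k = j` -/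

/-- `√(p q)` is irrational for distinct primes `p, q`. [folklore] -/
theorem irrational_sqrt_mul_of_prime {p q : ℕ} (hp : p.Prime) (hq : q.Prime) (hpq : p ≠ q) :
    Irrational (Real.sqrt ((p * q : ℕ) : ℝ)) := by
  rw [irrational_sqrt_natCast_iff]
  rintro ⟨c, hc⟩
  have h1 : p ∣ c * c := ⟨q, hc.symm⟩
  have h2 : p ∣ c := (hp.dvd_mul.1 h1).elim id id
  obtain ⟨e, rfl⟩ := h2
  have h3 : p * q = p * (p * e * e) := by rw [hc]; ring
  have h4 : q = p * e * e := Nat.eq_of_mul_eq_mul_left hp.pos h3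
  have h5 : p ∣ q := ⟨e * e, by rw [h4]; ring⟩
  exact hpq ((Nat.prime_dvd_prime_iff_eq hp hq).1 h5)

/-- The `k`-th prime is positive (as a real number). [folklore] -/
theorem nthPrime_cast_pos (k : ℕ) : (0 : ℝ) < ((Nat.nth Nat.Prime k : ℕ) : ℝ) := by
  exact_mod_cast (Nat.prime_nth_prime k).pos

/-- **Generic rulers.** If `u_k² = t_k · √p_k` with `t_k` positive rationals and `p_k` the `k`-th prime, then
`√m · u_k = √m' · u_j` with `m, m' ≥ 1` forces `k = j`: the femto grids `{√m · u_k}` of different steps never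
collide, for ANY choice of the rationals `t_k` (so each `u_k` may be placed in any prescribed interval). [folklore] -/
theorem step_eq_of_sqrt_mul_eq {t : ℕ → ℚ} (ht : ∀ k, 0 < t k) {u : ℕ → ℝ}
    (hu : ∀ k, u k ^ 2 = (t k : ℝ) * Real.sqrt ((Nat.nth Nat.Prime k : ℕ) : ℝ)) {k j : ℕ} {m m' : ℕ} (hm : 1 ≤ m)
    (h : Real.sqrt m * u k = Real.sqrt m' * u j) : k = j := by
  by_contra hkj
  have hp : (Nat.nth Nat.Prime k).Prime := Nat.prime_nth_prime k
  have hq : (Nat.nth Nat.Prime j).Prime := Nat.prime_nth_prime j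
  have hpq : Nat.nth Nat.Prime k ≠ Nat.nth Nat.Prime j :=
    fun e => hkj (Nat.nth_injective Nat.infinite_setOf_prime e)
  have hirr := irrational_sqrt_mul_of_prime hp hq hpq
  -- square the collision: `m t_k √p_k = m' t_j √p_j`
  have hsq : (m : ℝ) * ((t k : ℝ) * Real.sqrt ((Nat.nth Nat.Prime k : ℕ) : ℝ)) =
      (m' : ℝ) * ((t j : ℝ) * Real.sqrt ((Nat.nth Nat.Prime j : ℕ) : ℝ)) := by
    have := congrArg (fun x : ℝ => x ^ 2) h
    simp only [mul_pow, Real.sq_sqrt (Nat.cast_nonneg _), hu] at this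
    exact this
  -- multiply by `√p_j`: `√(p_k p_j) · (m t_k) = m' t_j p_j`
  have hpj : Real.sqrt ((Nat.nth Nat.Prime j : ℕ) : ℝ) * Real.sqrt ((Nat.nth Nat.Prime j : ℕ) : ℝ) =
      ((Nat.nth Nat.Prime j : ℕ) : ℝ) :=
    Real.mul_self_sqrt (nthPrime_cast_pos j).le
  have hprod : Real.sqrt (((Nat.nth Nat.Prime k * Nat.nth Nat.Prime j : ℕ) : ℝ)) =
      Real.sqrt ((Nat.nth Nat.Prime k : ℕ) : ℝ) * Real.sqrt ((Nat.nth Nat.Prime j : ℕ) : ℝ) := by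
    rw [Nat.cast_mul, Real.sqrt_mul (Nat.cast_nonneg _)]
  have hne : (m : ℝ) * (t k : ℝ) ≠ 0 := by
    have h1 : (0 : ℝ) < m := by exact_mod_cast hm
    have h2 : (0 : ℝ) < t k := by exact_mod_cast ht k
    positivity
  have key : Real.sqrt (((Nat.nth Nat.Prime k * Nat.nth Nat.Prime j : ℕ) : ℝ)) =
      ((m' : ℝ) * (t j : ℝ) * ((Nat.nth Nat.Prime j : ℕ) : ℝ)) / ((m : ℝ) * (t k : ℝ)) := by
    rw [hprod, eq_div_iff hne]
    calc Real.sqrt ((Nat.nth Nat.Prime k : ℕ) : ℝ) * Real.sqrt ((Nat.nth Nat.Prime j : ℕ) : ℝ) * ((m : ℝ) * (t k : ℝ))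
        = ((m : ℝ) * ((t k : ℝ) * Real.sqrt ((Nat.nth Nat.Prime k : ℕ) : ℝ))) * Real.sqrt ((Nat.nth Nat.Prime j : ℕ) : ℝ) := by ring
      _ = ((m' : ℝ) * ((t j : ℝ) * Real.sqrt ((Nat.nth Nat.Prime j : ℕ) : ℝ))) * Real.sqrt ((Nat.nth Nat.Prime j : ℕ) : ℝ) := by rw [hsq]
      _ = (m' : ℝ) * (t j : ℝ) * ((Nat.nth Nat.Prime j : ℕ) : ℝ) := by rw [mul_assoc, mul_assoc, hpj, ← mul_assoc]
  apply hirr.ne_rat ((m' : ℚ) * t j * (Nat.nth Nat.Prime j : ℚ) / ((m : ℚ) * t k))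
  rw [key]
  push_cast
  ring

/-! ## The construction -/

/-- **Slow rulers above any vanishing floor, from fixed-side two-sided `β⁻²` bounds (abstract form of the
generic-step encoding).** Data: for every `m` (think: the periodic torus of side `m + 1`) an "axis family"
`X m β n` (think: `n⁸ Cov_{β, m+1}(P_0^{01}, P_{n e₂}^{01})`), a non-negative "pair family" `Y m β i` indexed by
`i : ι m` (think: `|Cov_{β, m+1}(P_x^{ij}, P_y^{i'j'})| dist(x, y)⁸` over pairs of distinct sites and planes) and
"distances" `D m i` that are square roots of positive integers (torus distances are). Hypothesis: beyond a
threshold `B(m)` depending on `m` and otherwise arbitrary, `c₀ ≤ β² X m β n ≤ C₀` for `1 ≤ n ≤ (m+1)/8` and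
`β² Y m β i ≤ C₀`, with `0 < c₀` and `C₀` uniform in `m`. Conclusion: above ANY function `ω → 0` there are a unit map
`a > 0`, `a → 0` and a shape function `Γ ∈ (0, 1]` such that every "femto box" (`(m + 1) · a(β) ≤ 1`, `β ≥ β₀`)
satisfies the two-sided package `c₀/4 · Γ(n a(β)) ≤ X m β n ≤ C₀ Γ(n a(β))`, `Y m β i ≤ C₀ Γ(D m i · a(β))`, and
`ω(2^k) ≤ a(β)` on the whole dyadic block `k = Nat.log 2 ⌊β⌋₊` (so `ω ≤ a` on `[1, ∞)` whenever `ω` is antitone,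
and `ω(2^k) ≤ a(2^k)` always: `exists_slow_ruler`). Construction: cumulative thresholds `T'`, `M(β) = max {m : T' m ≤ β}`
(`Nat.findGreatest`), dyadic steps `a(β) = u_k` on `[2^k, 2^{k+1})` (`k = Nat.log 2 ⌊β⌋₊`) with GENERIC values
`u_k = √(t_k √p_k) ∈ (lo_k, 2 lo_k)`, `lo_k = max(1/(M(2^k) + 2), ω(2^k))`, `t_k ∈ ℚ` (`step_eq_of_sqrt_mul_eq`: the
grids `{√q · u_k}` of different steps never meet), `Γ := 4^{-k}` on the `k`-th grid and `1` elsewhere; the femto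
condition forces `m ≤ M(2^k)`, a good side, and `β² ∈ [4^k, 4^{k+1})` on the block. Pure order bookkeeping. [folklore] -/
theorem exists_slow_ruler_blocks {ι : ℕ → Type} (X : ℕ → ℝ → ℕ → ℝ) (Y : (m : ℕ) → ℝ → ι m → ℝ)
    (D : (m : ℕ) → ι m → ℝ) (hYnn : ∀ m β i, 0 ≤ Y m β i)
    (hD : ∀ m i, ∃ q : ℕ, 1 ≤ q ∧ D m i = Real.sqrt q) {c₀ C₀ : ℝ} (hc₀ : 0 < c₀) {B : ℕ → ℝ}
    (hB : ∀ (m : ℕ) (β : ℝ), B m ≤ β →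
      (∀ n : ℕ, 1 ≤ n → 8 * n ≤ m + 1 → c₀ ≤ β ^ 2 * X m β n ∧ β ^ 2 * X m β n ≤ C₀) ∧
        ∀ i : ι m, β ^ 2 * Y m β i ≤ C₀)
    (ω : ℝ → ℝ) (hω : Tendsto ω atTop (𝓝 0)) :
    ∃ (a Γ : ℝ → ℝ) (β₀ : ℝ), (∀ β, 0 < a β) ∧ Tendsto a atTop (𝓝 0) ∧ (∀ s, 0 < Γ s ∧ Γ s ≤ 1) ∧
      (∀ (m : ℕ) (β : ℝ), β₀ ≤ β → ((m : ℝ) + 1) * a β ≤ 1 →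
        (∀ n : ℕ, 1 ≤ n → 8 * n ≤ m + 1 →
            c₀ / 4 * Γ ((n : ℝ) * a β) ≤ X m β n ∧ X m β n ≤ C₀ * Γ ((n : ℝ) * a β)) ∧
          ∀ i : ι m, Y m β i ≤ C₀ * Γ (D m i * a β)) ∧
      ∀ β : ℝ, ω (2 ^ Nat.log 2 ⌊β⌋₊) ≤ a β := by
  classical
  -- monotone envelope of the thresholds, `T' m ≥ max (B m) m`
  let T' : ℕ → ℝ := fun m => (∑ k ∈ Finset.range (m + 1), |B k|) + m
  have hT'T : ∀ m, B m ≤ T' m := fun m => by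
    have h1 : |B m| ≤ ∑ k ∈ Finset.range (m + 1), |B k| :=
      Finset.single_le_sum (fun k _ => abs_nonneg (B k)) (Finset.self_mem_range_succ m)
    have h2 := le_abs_self (B m)
    have h3 : (0 : ℝ) ≤ m := Nat.cast_nonneg m
    simp only [T']
    linarith
  have hT'm : ∀ m : ℕ, (m : ℝ) ≤ T' m := fun m => by
    have := Finset.sum_nonneg fun k (_ : k ∈ Finset.range (m + 1)) => abs_nonneg (B k)
    simp only [T']
    linarith
  have hT'mono : ∀ {m m' : ℕ}, m ≤ m' → T' m ≤ T' m' := fun {m m'} hmm' => by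
    simp only [T']
    have h1 : ∑ k ∈ Finset.range (m + 1), |B k| ≤ ∑ k ∈ Finset.range (m' + 1), |B k| :=
      Finset.sum_le_sum_of_subset_of_nonneg (Finset.range_mono (by omega)) fun k _ _ => abs_nonneg (B k)
    have h2 : (m : ℝ) ≤ m' := by exact_mod_cast hmm'
    linarith
  -- `M β` = the largest `m` whose envelope threshold is `≤ β`
  let M : ℝ → ℕ := fun β => Nat.findGreatest (fun m => T' m ≤ β) ⌊β⌋₊
  have hMspec : ∀ β, T' 0 ≤ β → T' (M β) ≤ β := fun β h0 =>
    Nat.findGreatest_spec (P := fun m => T' m ≤ β) (Nat.zero_le _) h0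
  have hMge : ∀ β m, T' m ≤ β → m ≤ M β := fun β m hm =>
    Nat.le_findGreatest (Nat.le_floor ((hT'm m).trans hm)) hm
  -- dyadic steps: `Mk k` = the good torus sides at couplings `≥ 2^k`; `lo k` = floor of the `k`-th value
  let Mk : ℕ → ℕ := fun k => M ((2 : ℝ) ^ k)
  let lo : ℕ → ℝ := fun k => max (1 / ((Mk k : ℝ) + 2)) (ω ((2 : ℝ) ^ k))
  have hlo_pos : ∀ k, 0 < lo k := fun k => lt_max_of_lt_left (by positivity)
  have hlo_ge : ∀ k, 1 / ((Mk k : ℝ) + 2) ≤ lo k := fun k => le_max_left _ _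
  have hlo_geω : ∀ k, ω ((2 : ℝ) ^ k) ≤ lo k := fun k => le_max_right _ _
  -- generic values `u k ∈ (lo k, 2 lo k)` with `u_k² = t_k √p_k`, `t_k ∈ ℚ`
  have hsp : ∀ k, 0 < Real.sqrt ((Nat.nth Nat.Prime k : ℕ) : ℝ) := fun k => Real.sqrt_pos.2 (nthPrime_cast_pos k)
  have ht : ∀ k, ∃ q : ℚ, lo k ^ 2 / Real.sqrt ((Nat.nth Nat.Prime k : ℕ) : ℝ) < q ∧
      (q : ℝ) < 4 * lo k ^ 2 / Real.sqrt ((Nat.nth Nat.Prime k : ℕ) : ℝ) := fun k => by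
    refine exists_rat_btwn ?_
    rw [div_lt_div_iff_of_pos_right (hsp k)]
    have h2 : 0 < lo k ^ 2 := by positivity
    linarith
  choose t ht1 ht2 using ht
  have htpos : ∀ k, (0 : ℝ) < t k := fun k =>
    lt_trans (div_pos (pow_pos (hlo_pos k) 2) (hsp k)) (ht1 k)
  have htposQ : ∀ k, 0 < t k := fun k => by exact_mod_cast htpos k
  let u : ℕ → ℝ := fun k => Real.sqrt ((t k : ℝ) * Real.sqrt ((Nat.nth Nat.Prime k : ℕ) : ℝ))
  have hu_nonneg : ∀ k, 0 ≤ u k := fun k => Real.sqrt_nonneg _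
  have hu_sq : ∀ k, u k ^ 2 = (t k : ℝ) * Real.sqrt ((Nat.nth Nat.Prime k : ℕ) : ℝ) := fun k =>
    Real.sq_sqrt (mul_nonneg (htpos k).le (hsp k).le)
  have hu_gt : ∀ k, lo k < u k := fun k => by
    show lo k < Real.sqrt ((t k : ℝ) * Real.sqrt ((Nat.nth Nat.Prime k : ℕ) : ℝ))
    rw [Real.lt_sqrt (hlo_pos k).le]
    have := ht1 k
    rw [div_lt_iff₀ (hsp k)] at this
    exact this
  have hu_lt : ∀ k, u k < 2 * lo k := fun k => by
    show Real.sqrt ((t k : ℝ) * Real.sqrt ((Nat.nth Nat.Prime k : ℕ) : ℝ)) < 2 * lo k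
    rw [Real.sqrt_lt' (by linarith [hlo_pos k])]
    have := ht2 k
    rw [lt_div_iff₀ (hsp k)] at this
    nlinarith
  have hu_pos : ∀ k, 0 < u k := fun k => (hlo_pos k).trans (hu_gt k)
  -- freshness of the femto grids across steps
  have hfresh : ∀ {k j m m' : ℕ}, 1 ≤ m → Real.sqrt m * u k = Real.sqrt m' * u j → k = j :=
    fun hm h => step_eq_of_sqrt_mul_eq htposQ hu_sq hm h
  -- the shape function: `4^{-k}` on the `k`-th grid, `1` elsewhere
  let P : ℝ → ℕ → Prop := fun s k => ∃ m : ℕ, 1 ≤ m ∧ s = Real.sqrt m * u k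
  let Γ : ℝ → ℝ := fun s => if h : ∃ k, P s k then (1 / 4 : ℝ) ^ Nat.find h else 1
  have hΓ_val : ∀ k m : ℕ, 1 ≤ m → Γ (Real.sqrt m * u k) = (1 / 4 : ℝ) ^ k := by
    intro k m hm
    have h : ∃ k', P (Real.sqrt m * u k) k' := ⟨k, m, hm, rfl⟩
    simp only [Γ, dif_pos h]
    congr 1
    obtain ⟨m', -, he⟩ := Nat.find_spec h
    exact (hfresh hm he).symm
  have hΓ_bounds : ∀ s, 0 < Γ s ∧ Γ s ≤ 1 := fun s => by
    simp only [Γ]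
    split_ifs
    · exact ⟨by positivity, pow_le_one₀ (by norm_num) (by norm_num)⟩
    · exact ⟨one_pos, le_rfl⟩
  -- the unit map: the `k`-th value on the dyadic block `[2^k, 2^{k+1})`
  let a : ℝ → ℝ := fun β => u (Nat.log 2 ⌊β⌋₊)
  obtain ⟨k₀, hk₀⟩ : ∃ k₀ : ℕ, T' 0 < (2 : ℝ) ^ k₀ := pow_unbounded_of_one_lt (T' 0) one_lt_two
  have hcast2 : ∀ k : ℕ, ((2 ^ k : ℕ) : ℝ) = (2 : ℝ) ^ k := fun k => by push_cast; ring
  refine ⟨a, Γ, (2 : ℝ) ^ k₀, fun β => hu_pos _, ?_, hΓ_bounds, ?_, ?_⟩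
  · -- `a → 0`
    have hM_tendsto : Tendsto (fun k : ℕ => (Mk k : ℝ)) atTop atTop := by
      refine tendsto_natCast_atTop_atTop.comp (tendsto_atTop_atTop.2 fun m => ?_)
      obtain ⟨K, hK⟩ : ∃ K : ℕ, T' m < (2 : ℝ) ^ K := pow_unbounded_of_one_lt (T' m) one_lt_two
      refine ⟨K, fun k hk => hMge _ m (hK.le.trans ?_)⟩
      exact pow_le_pow_right₀ one_le_two hk
    have hlo_tendsto : Tendsto lo atTop (𝓝 0) := by
      have h1 : Tendsto (fun k => 1 / ((Mk k : ℝ) + 2)) atTop (𝓝 0) := by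
        simp only [one_div]
        exact (hM_tendsto.atTop_add tendsto_const_nhds).inv_tendsto_atTop
      have h2 : Tendsto (fun k : ℕ => ω ((2 : ℝ) ^ k)) atTop (𝓝 0) :=
        hω.comp (tendsto_pow_atTop_atTop_of_one_lt one_lt_two)
      show Tendsto (fun k => max (1 / ((Mk k : ℝ) + 2)) (ω ((2 : ℝ) ^ k))) atTop (𝓝 0)
      have h3 := h1.max h2
      rwa [max_self] at h3
    have hu_tendsto : Tendsto u atTop (𝓝 0) :=
      tendsto_of_tendsto_of_tendsto_of_le_of_le tendsto_const_nhds
        (by simpa using hlo_tendsto.const_mul 2) (fun k => (hu_pos k).le) (fun k => (hu_lt k).le)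
    have hlog : Tendsto (fun β : ℝ => Nat.log 2 ⌊β⌋₊) atTop atTop := by
      refine tendsto_atTop_atTop.2 fun b => ⟨(2 : ℝ) ^ b, fun β hβ => ?_⟩
      refine Nat.le_log_of_pow_le one_lt_two (Nat.le_floor ?_)
      rw [hcast2]
      exact hβ
    exact hu_tendsto.comp hlog
  · -- the femto boxes
    intro m' β hβ hL
    set k := Nat.log 2 ⌊β⌋₊ with hk
    have ha : a β = u k := rfl
    have h1k₀ : (1 : ℝ) ≤ (2 : ℝ) ^ k₀ := one_le_pow₀ one_le_two
    have h1β : (1 : ℝ) ≤ β := h1k₀.trans hβ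
    have hfloor_pos : ⌊β⌋₊ ≠ 0 := (Nat.floor_pos.2 h1β).ne'
    have h2k : (2 : ℝ) ^ k ≤ β := by
      have h := Nat.pow_log_le_self 2 hfloor_pos
      calc (2 : ℝ) ^ k = ((2 ^ k : ℕ) : ℝ) := (hcast2 k).symm
        _ ≤ (⌊β⌋₊ : ℝ) := by exact_mod_cast h
        _ ≤ β := Nat.floor_le (by linarith)
    have hβlt : β < (2 : ℝ) ^ (k + 1) := by
      have h : ⌊β⌋₊ < 2 ^ (k + 1) := Nat.lt_pow_succ_log_self one_lt_two ⌊β⌋₊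
      have h' : ⌊β⌋₊ + 1 ≤ 2 ^ (k + 1) := h
      calc β < (⌊β⌋₊ : ℝ) + 1 := Nat.lt_floor_add_one β
        _ = ((⌊β⌋₊ + 1 : ℕ) : ℝ) := by push_cast; ring
        _ ≤ ((2 ^ (k + 1) : ℕ) : ℝ) := by exact_mod_cast h'
        _ = (2 : ℝ) ^ (k + 1) := hcast2 (k + 1)
    have hk₀k : k₀ ≤ k := by
      refine Nat.le_log_of_pow_le one_lt_two (Nat.le_floor ?_)
      rw [hcast2]
      exact hβ
    have hT0 : T' 0 ≤ (2 : ℝ) ^ k := hk₀.le.trans (pow_le_pow_right₀ one_le_two hk₀k)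
    -- femto ⇒ the torus side is good: `m' ≤ Mk k`
    have hMk : m' ≤ Mk k := by
      have hu1 : 1 / ((Mk k : ℝ) + 2) < u k := (hlo_ge k).trans_lt (hu_gt k)
      have hlt : (m' : ℝ) + 1 < (Mk k : ℝ) + 2 := by
        by_contra hcon
        push Not at hcon
        have h1 : (1 : ℝ) < ((m' : ℝ) + 1) * u k := by
          calc (1 : ℝ) = ((Mk k : ℝ) + 2) * (1 / ((Mk k : ℝ) + 2)) := by field_simp
            _ < ((Mk k : ℝ) + 2) * u k := mul_lt_mul_of_pos_left hu1 (by positivity)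
            _ ≤ ((m' : ℝ) + 1) * u k := mul_le_mul_of_nonneg_right hcon (hu_nonneg k)
        rw [ha] at hL
        linarith
      have hlt' : ((m' + 1 : ℕ) : ℝ) < ((Mk k + 2 : ℕ) : ℝ) := by push_cast; exact hlt
      have hlt'' : m' + 1 < Mk k + 2 := by exact_mod_cast hlt'
      omega
    have hgood := hB m' β (by
      calc B m' ≤ T' m' := hT'T m'
        _ ≤ T' (Mk k) := hT'mono hMk
        _ ≤ (2 : ℝ) ^ k := hMspec _ hT0
        _ ≤ β := h2k)
    obtain ⟨hax, hpr⟩ := hgood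
    have hβpos : 0 < β := by linarith
    have h4 : (4 : ℝ) = 2 ^ 2 := by norm_num
    have hβ2lo : (4 : ℝ) ^ k ≤ β ^ 2 := by
      calc (4 : ℝ) ^ k = ((2 : ℝ) ^ k) ^ 2 := by rw [h4, ← pow_mul, ← pow_mul, mul_comm]
        _ ≤ β ^ 2 := pow_le_pow_left₀ (by positivity) h2k 2
    have hβ2hi : β ^ 2 ≤ (4 : ℝ) ^ (k + 1) := by
      calc β ^ 2 ≤ ((2 : ℝ) ^ (k + 1)) ^ 2 := pow_le_pow_left₀ hβpos.le hβlt.le 2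
        _ = (4 : ℝ) ^ (k + 1) := by rw [h4, ← pow_mul, ← pow_mul, mul_comm]
    have hq : (1 / 4 : ℝ) ^ k = 1 / (4 : ℝ) ^ k := by rw [one_div_pow]
    refine ⟨fun n hn hnL => ?_, fun i => ?_⟩
    · obtain ⟨hlow, hup⟩ := hax n hn hnL
      have hΓn : Γ ((n : ℝ) * a β) = (1 / 4 : ℝ) ^ k := by
        have hn' : ((n : ℕ) : ℝ) = Real.sqrt ((n * n : ℕ) : ℝ) := by
          push_cast
          exact (Real.sqrt_mul_self (Nat.cast_nonneg n)).symm
        rw [ha, hn']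
        exact hΓ_val k (n * n) (Nat.one_le_iff_ne_zero.2 (Nat.mul_ne_zero (by omega) (by omega)))
      rw [hΓn]
      set X := X m' β n with hX
      have hβ2 : 0 < β ^ 2 := by positivity
      have hXlow : c₀ / β ^ 2 ≤ X := by
        rw [div_le_iff₀ hβ2]
        linarith [mul_comm (β ^ 2) X]
      have hC₀ : 0 ≤ C₀ := hc₀.le.trans (hlow.trans hup)
      have hXup : X ≤ C₀ / β ^ 2 := by
        rw [le_div_iff₀ hβ2]
        linarith [mul_comm (β ^ 2) X]
      constructor
      · calc c₀ / 4 * (1 / 4 : ℝ) ^ k = c₀ / (4 : ℝ) ^ (k + 1) := by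
              rw [hq, pow_succ]; field_simp
          _ ≤ c₀ / β ^ 2 := div_le_div_of_nonneg_left hc₀.le hβ2 hβ2hi
          _ ≤ X := hXlow
      · calc X ≤ C₀ / β ^ 2 := hXup
          _ ≤ C₀ / (4 : ℝ) ^ k := div_le_div_of_nonneg_left hC₀ (by positivity) hβ2lo
          _ = C₀ * (1 / 4 : ℝ) ^ k := by rw [hq]; field_simp
    · obtain ⟨msq, hmsq, hd⟩ := hD m' i
      have hΓd : Γ (D m' i * a β) = (1 / 4 : ℝ) ^ k := by
        rw [hd, ha]
        exact hΓ_val k msq hmsq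
      rw [hΓd]
      have h := hpr i
      set Y := Y m' β i with hY
      have hβ2 : 0 < β ^ 2 := by positivity
      have hY0 : 0 ≤ Y := hYnn m' β i
      have hC₀ : 0 ≤ C₀ := le_trans (by positivity) h
      have hYup : Y ≤ C₀ / β ^ 2 := by
        rw [le_div_iff₀ hβ2]
        linarith [mul_comm (β ^ 2) Y]
      calc Y ≤ C₀ / β ^ 2 := hYup
        _ ≤ C₀ / (4 : ℝ) ^ k := div_le_div_of_nonneg_left hC₀ (by positivity) hβ2lo
        _ = C₀ * (1 / 4 : ℝ) ^ k := by rw [hq]; field_simp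
  · -- slow: `ω (2^k) ≤ a β` on the whole dyadic block `k = Nat.log 2 ⌊β⌋₊`
    intro β
    exact (hlo_geω _).trans (hu_gt _).le

/-- **Slow rulers above any vanishing floor** (dyadic form): as `exists_slow_ruler_blocks`, with the domination
clause at the dyadic couplings, `ω(2^k) ≤ a(2^k)` for every `k` (`Nat.log 2 ⌊2^k⌋₊ = k`). [folklore] -/
theorem exists_slow_ruler {ι : ℕ → Type} (X : ℕ → ℝ → ℕ → ℝ) (Y : (m : ℕ) → ℝ → ι m → ℝ)
    (D : (m : ℕ) → ι m → ℝ) (hYnn : ∀ m β i, 0 ≤ Y m β i)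
    (hD : ∀ m i, ∃ q : ℕ, 1 ≤ q ∧ D m i = Real.sqrt q) {c₀ C₀ : ℝ} (hc₀ : 0 < c₀) {B : ℕ → ℝ}
    (hB : ∀ (m : ℕ) (β : ℝ), B m ≤ β →
      (∀ n : ℕ, 1 ≤ n → 8 * n ≤ m + 1 → c₀ ≤ β ^ 2 * X m β n ∧ β ^ 2 * X m β n ≤ C₀) ∧
        ∀ i : ι m, β ^ 2 * Y m β i ≤ C₀)
    (ω : ℝ → ℝ) (hω : Tendsto ω atTop (𝓝 0)) :
    ∃ (a Γ : ℝ → ℝ) (β₀ : ℝ), (∀ β, 0 < a β) ∧ Tendsto a atTop (𝓝 0) ∧ (∀ s, 0 < Γ s ∧ Γ s ≤ 1) ∧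
      (∀ (m : ℕ) (β : ℝ), β₀ ≤ β → ((m : ℝ) + 1) * a β ≤ 1 →
        (∀ n : ℕ, 1 ≤ n → 8 * n ≤ m + 1 →
            c₀ / 4 * Γ ((n : ℝ) * a β) ≤ X m β n ∧ X m β n ≤ C₀ * Γ ((n : ℝ) * a β)) ∧
          ∀ i : ι m, Y m β i ≤ C₀ * Γ (D m i * a β)) ∧
      ∀ k : ℕ, ω (2 ^ k) ≤ a (2 ^ k) := by
  obtain ⟨a, Γ, β₀, hpos, hlim, hΓ, hbox, hslow⟩ := exists_slow_ruler_blocks X Y D hYnn hD hc₀ hB ω hω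
  refine ⟨a, Γ, β₀, hpos, hlim, hΓ, hbox, fun k => ?_⟩
  have h := hslow ((2 : ℝ) ^ k)
  have hfl : ⌊(2 : ℝ) ^ k⌋₊ = 2 ^ k := by
    rw [show (2 : ℝ) ^ k = ((2 ^ k : ℕ) : ℝ) by push_cast; ring, Nat.floor_natCast]
  rwa [hfl, Nat.log_pow one_lt_two] at h

/-- **Slow rulers above any ANTITONE vanishing floor, everywhere on `[1, ∞)`**: as `exists_slow_ruler_blocks`; for
antitone `ω` the block clause gives `ω(β) ≤ ω(2^k) ≤ a(β)` since `2^k ≤ β` on the block. This is the form consumed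
by the negative lemma with the WEAK infrared hypothesis (correlation length unbounded along SOME sequence of
couplings). [folklore] -/
theorem exists_slow_ruler_antitone {ι : ℕ → Type} (X : ℕ → ℝ → ℕ → ℝ) (Y : (m : ℕ) → ℝ → ι m → ℝ)
    (D : (m : ℕ) → ι m → ℝ) (hYnn : ∀ m β i, 0 ≤ Y m β i)
    (hD : ∀ m i, ∃ q : ℕ, 1 ≤ q ∧ D m i = Real.sqrt q) {c₀ C₀ : ℝ} (hc₀ : 0 < c₀) {B : ℕ → ℝ}
    (hB : ∀ (m : ℕ) (β : ℝ), B m ≤ β →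
      (∀ n : ℕ, 1 ≤ n → 8 * n ≤ m + 1 → c₀ ≤ β ^ 2 * X m β n ∧ β ^ 2 * X m β n ≤ C₀) ∧
        ∀ i : ι m, β ^ 2 * Y m β i ≤ C₀)
    (ω : ℝ → ℝ) (hω : Tendsto ω atTop (𝓝 0)) (hanti : Antitone ω) :
    ∃ (a Γ : ℝ → ℝ) (β₀ : ℝ), (∀ β, 0 < a β) ∧ Tendsto a atTop (𝓝 0) ∧ (∀ s, 0 < Γ s ∧ Γ s ≤ 1) ∧
      (∀ (m : ℕ) (β : ℝ), β₀ ≤ β → ((m : ℝ) + 1) * a β ≤ 1 →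
        (∀ n : ℕ, 1 ≤ n → 8 * n ≤ m + 1 →
            c₀ / 4 * Γ ((n : ℝ) * a β) ≤ X m β n ∧ X m β n ≤ C₀ * Γ ((n : ℝ) * a β)) ∧
          ∀ i : ι m, Y m β i ≤ C₀ * Γ (D m i * a β)) ∧
      ∀ β : ℝ, 1 ≤ β → ω β ≤ a β := by
  obtain ⟨a, Γ, β₀, hpos, hlim, hΓ, hbox, hslow⟩ := exists_slow_ruler_blocks X Y D hYnn hD hc₀ hB ω hω
  refine ⟨a, Γ, β₀, hpos, hlim, hΓ, hbox, fun β hβ => le_trans (hanti ?_) (hslow β)⟩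
  -- `2 ^ (Nat.log 2 ⌊β⌋₊) ≤ β`
  have hfloor : ⌊β⌋₊ ≠ 0 := (Nat.floor_pos.2 hβ).ne'
  have h := Nat.pow_log_le_self 2 hfloor
  calc (2 : ℝ) ^ Nat.log 2 ⌊β⌋₊ = ((2 ^ Nat.log 2 ⌊β⌋₊ : ℕ) : ℝ) := by push_cast; ring
    _ ≤ (⌊β⌋₊ : ℝ) := by exact_mod_cast h
    _ ≤ β := Nat.floor_le (by linarith)

end

end Summit.QuantumFields.YangMills.Theorems.LatticeGapInUVUnits.Negative
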